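import Summits.BirchSwinnertonDyer.Rank1Residual.GaloisImage.CubicRootStabilizer
import Literature.NumberTheory.EllipticCurves.Sha
import Literature.NumberTheory.EllipticCurves.ReductionHomomorphism
import HarnessLib

/-!
# Coordinates in `E(α)`: the record-side glue for the unramified-cubic witness road
# (cell `b2b-bsdres`, team n1011, seat p10 GEN 8; row T-VIS3-UC, FILE 4b; note
# `HOME/b2b-bsdres-n1011-p10/g8/L41-NOTE.md`, skeleton `cells/n1011/skel/T-VIS3-UC.md`)

HONEST FRAMING (cell `b2b-bsdres`, run/shared/lean/b2b/bsd-rank1-residual/, verbatim in every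
file): the goal of the cell is to DELETE the COMBINATION-SHAPED residual classes of the
Birch–Swinnerton-Dyer formula for ALL analytic-rank `≤ 1` elliptic curves over `ℚ` — "full BSD
formula for every rank `≤ 1` curve in class `C`" assembled STRICTLY from published theorems — so
that the rank-`≤ 1` remainder becomes exactly the CONSTRUCTION-SHAPED classes, which are TYPED
(missing-input `Prop`s), NOT attempted. This is not "finishing BSD". Team n1011 (N10 / N11):
research route on the CONSTRUCTION-SHAPED class X4 (§I N11 LOWER half); no claim beyond the stated
classes; nothing is booked; marks UNCHANGED. Theorems only: no definition, no named fact, no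
`sorry`. TOOL theorems; they close nothing by themselves.

## What

The `ℚ` record shape `exists_sha_ne_zero_of_congr_of_unramifiedCubicWitness` (FILE 6) asks for points
`Q'`, `Q₁` of `E'(K̄_{ℚ₃})`, `E(K̄_{ℚ₃})` FIXED by every `σ ∈ Γ_{ℚ₃}` fixing a root `α` of
`X³ − X − 1`, and for `Q₁` NOT fixed by some `σ`. A decider produces such points by their
COORDINATES `c₀ + c₁ α + c₂ α²` (`cᵢ ∈ ℚ₃`). This file is the glue, for any field `E` of
characteristic `0` and any root `α`:

* `smul_coords_eq_of_smul_eq` — an element fixing `α` fixes `c₀ + c₁ α + c₂ α²`;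
* `exists_smul_coords_ne` — if `X³ − X − 1` has no root in `E` and `c₁ ≠ 0 ∨ c₂ ≠ 0`, some
  `σ ∈ Γ_E` moves `c₀ + c₁ α + c₂ α²` (it is not in `E`, the minimal polynomial of `α` having
  degree `3`: Mathlib `minpoly.degree_le_of_ne_zero`);
* `smul_point_eq_of_apply_eq` / `smul_point_ne_of_apply_ne` — the same read on points of
  `E(K̄_E) = localPoints W E` (`localPoints.smul_def`, `Affine.Point.map_some`);
* `stabilizer_smul_point_eq_of_coords`, `exists_smul_point_ne_of_coords` — the binders `hQ'H`,
  `hQ₁H`, `hQ₁m` of FILE 6 from coordinate data.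

References: Mathlib `FieldTheory.Minpoly.Field`; [SilvermanAEC2009] VIII.§1 (Galois action on points).
-/

noncomputable section

open scoped Classical

namespace Summit.BirchSwinnertonDyer.Rank1Residual.GaloisImage.TwistedWitness

open Field Polynomial Literature.NumberTheory.EllipticCurves Literature.NumberTheory.GaloisRepresentations

section Coords

variable {E : Type} [Field E] [CharZero E] {α : AlgebraicClosure E}

/-- An element of `Γ_E` fixing `α` fixes `c₀ + c₁ α + c₂ α²` (`cᵢ ∈ E`). [folklore] -/
theorem smul_coords_eq_of_smul_eq {h : absoluteGaloisGroup E} (hh : h • α = α) (c₀ c₁ c₂ : E) :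
    h • (algebraMap E (AlgebraicClosure E) c₀ + algebraMap E (AlgebraicClosure E) c₁ * α +
        algebraMap E (AlgebraicClosure E) c₂ * α ^ 2) =
      algebraMap E (AlgebraicClosure E) c₀ + algebraMap E (AlgebraicClosure E) c₁ * α +
        algebraMap E (AlgebraicClosure E) c₂ * α ^ 2 := by
  rw [absoluteGaloisGroup.smul_def] at hh ⊢
  simp only [map_add, map_mul, map_pow, AlgEquiv.commutes, hh]

/-- **An element `c₀ + c₁ α + c₂ α²` with `c₁ ≠ 0` or `c₂ ≠ 0` is moved by some `σ ∈ Γ_E`** when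
`X³ − X − 1` (with root `α`) has no root in `E`: otherwise it lies in `E`
(`absoluteGaloisGroup.exists_algebraMap_eq_pow_of_forall_smul_eq`) and `α` satisfies a non-zero
polynomial of degree `≤ 2` over `E`, contradicting `minpoly E α = X³ − X − 1`. [folklore] -/
theorem exists_smul_coords_ne (hα : α ^ 3 = α + 1) (hnoroot : ∀ x : E, x ^ 3 - x - 1 ≠ 0)
    (c₀ c₁ c₂ : E) (hc : c₁ ≠ 0 ∨ c₂ ≠ 0) :
    ∃ σ : absoluteGaloisGroup E,
      σ • (algebraMap E (AlgebraicClosure E) c₀ + algebraMap E (AlgebraicClosure E) c₁ * α +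
          algebraMap E (AlgebraicClosure E) c₂ * α ^ 2) ≠
        algebraMap E (AlgebraicClosure E) c₀ + algebraMap E (AlgebraicClosure E) c₁ * α +
          algebraMap E (AlgebraicClosure E) c₂ * α ^ 2 := by
  by_contra hall
  push Not at hall
  haveI : ExpChar E 1 := ExpChar.zero
  obtain ⟨m, e, he⟩ := absoluteGaloisGroup.exists_algebraMap_eq_pow_of_forall_smul_eq E 1 hall
  rw [one_pow, pow_one] at he
  -- `q = c₂ X² + c₁ X + (c₀ − e)` is a non-zero polynomial of degree ≤ 2 with `q(α) = 0`
  set q : E[X] := C c₂ * X ^ 2 + C c₁ * X + C (c₀ - e) with hq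
  have hq0 : q ≠ 0 := by
    intro h0
    have h1 : q.coeff 1 = 0 := by rw [h0, coeff_zero]
    have h2 : q.coeff 2 = 0 := by rw [h0, coeff_zero]
    simp only [hq, coeff_add, coeff_C_mul, coeff_X_pow, coeff_X, coeff_C] at h1 h2
    norm_num at h1 h2
    rcases hc with h | h
    · exact h h1
    · exact h h2
  have hqα : aeval α q = 0 := by
    simp only [hq, map_add, map_mul, aeval_C, aeval_X, map_pow, map_sub]
    rw [he]; ring
  have hdeg := minpoly.degree_le_of_ne_zero E α hq0 hqα
  rw [minpoly_cubicRoot hα hnoroot] at hdeg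
  have h3 : (X ^ 3 - X - 1 : E[X]).degree = 3 := by compute_degree!
  have h2 : q.degree ≤ 2 := by
    rw [hq]
    refine (degree_add_le _ _).trans (max_le ((degree_add_le _ _).trans (max_le ?_ ?_)) ?_)
    · exact (degree_C_mul_X_pow_le 2 c₂)
    · exact (degree_C_mul_X_le c₁).trans (by norm_num)
    · exact degree_C_le.trans (by norm_num)
  rw [h3] at hdeg
  have := hdeg.trans h2
  norm_num at this

end Coords

/-! ## On points of `E(K̄_E)` -/

section Points

variable {K : Type} [Field K] (W : WeierstrassCurve K) {E : Type} [Field E] [Algebra K E]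

/-- `σ ∈ Γ_E` fixes a point of `E(K̄_E)` whose affine coordinates it fixes. [folklore] -/
theorem smul_point_eq_of_apply_eq (σ : absoluteGaloisGroup E) {x y : AlgebraicClosure E}
    (h : (W.baseChange (AlgebraicClosure E)).toAffine.Nonsingular x y) (Q : localPoints W E)
    (hQ : Q = (show localPoints W E from WeierstrassCurve.Affine.Point.some x y h))
    (hx : absoluteGaloisGroup.toAlgEquiv E σ x = x) (hy : absoluteGaloisGroup.toAlgEquiv E σ y = y) :
    σ • Q = Q := by
  rw [hQ, localPoints.smul_def]
  change WeierstrassCurve.Affine.Point.map _ (WeierstrassCurve.Affine.Point.some x y h) =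
    WeierstrassCurve.Affine.Point.some x y h
  rw [WeierstrassCurve.Affine.Point.map_some]
  exact point_some_congr hx hy

/-- `σ ∈ Γ_E` moves a point of `E(K̄_E)` whose `x`-coordinate it moves. [folklore] -/
theorem smul_point_ne_of_apply_ne (σ : absoluteGaloisGroup E) {x y : AlgebraicClosure E}
    (h : (W.baseChange (AlgebraicClosure E)).toAffine.Nonsingular x y) (Q : localPoints W E)
    (hQ : Q = (show localPoints W E from WeierstrassCurve.Affine.Point.some x y h))
    (hx : absoluteGaloisGroup.toAlgEquiv E σ x ≠ x) : σ • Q ≠ Q := by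
  intro heq
  rw [hQ, localPoints.smul_def] at heq
  change WeierstrassCurve.Affine.Point.map _ (WeierstrassCurve.Affine.Point.some x y h) =
    WeierstrassCurve.Affine.Point.some x y h at heq
  rw [WeierstrassCurve.Affine.Point.map_some] at heq
  exact hx (WeierstrassCurve.Affine.Point.some.inj heq).1

variable [CharZero E] {α : AlgebraicClosure E}

/-- **Binders `hQ'H` / `hQ₁H` of the record shape from coordinates**: a point of `E(K̄_E)` with
coordinates `x = c₀ + c₁α + c₂α²`, `y = d₀ + d₁α + d₂α²` (`cᵢ, dᵢ ∈ E`) is fixed by every element of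
`Γ_E` fixing `α`. [folklore] -/
theorem stabilizer_smul_point_eq_of_coords {x y : AlgebraicClosure E}
    (h : (W.baseChange (AlgebraicClosure E)).toAffine.Nonsingular x y) (Q : localPoints W E)
    (hQ : Q = (show localPoints W E from WeierstrassCurve.Affine.Point.some x y h))
    (c₀ c₁ c₂ d₀ d₁ d₂ : E)
    (hx : x = algebraMap E (AlgebraicClosure E) c₀ + algebraMap E (AlgebraicClosure E) c₁ * α +
      algebraMap E (AlgebraicClosure E) c₂ * α ^ 2)
    (hy : y = algebraMap E (AlgebraicClosure E) d₀ + algebraMap E (AlgebraicClosure E) d₁ * α +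
      algebraMap E (AlgebraicClosure E) d₂ * α ^ 2)
    (σ : absoluteGaloisGroup E) (hσ : σ • α = α) : σ • Q = Q := by
  refine smul_point_eq_of_apply_eq W σ h Q hQ ?_ ?_
  · have := smul_coords_eq_of_smul_eq hσ c₀ c₁ c₂
    rw [← hx, absoluteGaloisGroup.smul_def] at this
    exact this
  · have := smul_coords_eq_of_smul_eq hσ d₀ d₁ d₂
    rw [← hy, absoluteGaloisGroup.smul_def] at this
    exact this

/-- **Binder `hQ₁m` of the record shape from coordinates**: a point of `E(K̄_E)` whose
`x`-coordinate is `c₀ + c₁α + c₂α²` with `c₁ ≠ 0` or `c₂ ≠ 0` is moved by some `σ ∈ Γ_E`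
(`α³ = α + 1`, `X³ − X − 1` rootless in `E`). [folklore] -/
theorem exists_smul_point_ne_of_coords (hα : α ^ 3 = α + 1) (hnoroot : ∀ x : E, x ^ 3 - x - 1 ≠ 0)
    {x y : AlgebraicClosure E} (h : (W.baseChange (AlgebraicClosure E)).toAffine.Nonsingular x y)
    (Q : localPoints W E)
    (hQ : Q = (show localPoints W E from WeierstrassCurve.Affine.Point.some x y h))
    (c₀ c₁ c₂ : E) (hc : c₁ ≠ 0 ∨ c₂ ≠ 0)
    (hx : x = algebraMap E (AlgebraicClosure E) c₀ + algebraMap E (AlgebraicClosure E) c₁ * α +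
      algebraMap E (AlgebraicClosure E) c₂ * α ^ 2) :
    ∃ σ : absoluteGaloisGroup E, σ • Q ≠ Q := by
  obtain ⟨σ, hσ⟩ := exists_smul_coords_ne hα hnoroot c₀ c₁ c₂ hc
  refine ⟨σ, smul_point_ne_of_apply_ne W σ h Q hQ ?_⟩
  rw [hx, ← absoluteGaloisGroup.smul_def]
  exact hσ

end Points

end Summit.BirchSwinnertonDyer.Rank1Residual.GaloisImage.TwistedWitness

end
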